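import Literature.AlgebraicGeometry.Motives.SemicontinuityGrothendieckComplex
import Mathlib.Algebra.Module.Projective
import Mathlib.RingTheory.Finiteness.Cardinality
import Mathlib.LinearAlgebra.TensorProduct.Pi
import Mathlib.LinearAlgebra.TensorProduct.Tower
import Mathlib.Data.Matrix.ColumnRowPartitioned
import HarnessLib

/-!
# From finitely generated projective modules to matrices: the linear algebra of the Grothendieck complex in degree `0` (Görtz–Wedhorn II, Prop. 22.53 / proof of Prop. 23.117)

`Motives/SemicontinuityGrothendieckComplex` vendors the one input of the semicontinuity theorem
(Görtz–Wedhorn II, Thm. 23.139 (2), `i = 0`) that needs coherent cohomology as the named fact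
`grothendieckComplex_h0`: for `X → Spec K` proper geometrically integral, `T` an integral
`K`-scheme, `D` a Cartier divisor on the integral scheme `X ×_K T` and `t₀ ∈ T`, some open `V ∋ t₀`
carries a **matrix** `M ∈ M_{n × m}(Γ(V, 𝒪_T))` with `H⁰(X_t, 𝒪(D_t)) ≅ Ker M(t)` for all `t ∈ V`.
The printed source of that matrix (pp. 360, 466, 480–482) is a complex of *finite locally free*
modules: by Cor. 23.135 with Rem. 23.134 the complex `Rf_*𝒪(D)` (`f = pr_T`) is perfect of
tor-amplitude in `[0, N]` over an affine base, so by Prop. 22.53 it is, over an affine open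
`V = Spec A`, a complex `E⁰ —d⁰→ E¹ → ⋯ → E^N` of finite locally free `𝒪_V`-modules, i.e. of finitely
generated projective `A`-modules, and by (23.28.5) `H⁰(X_t, 𝒪(D)_t) = H⁰(E^• ⊗ κ(t)) = Ker(d⁰ ⊗ κ(t))`
(`E^{-1} = 0`); the matrix is `d⁰` "in bases", which exist only after shrinking `V` (or, as below,
after realising `E⁰`, `E¹` as direct summands of free modules).

This file PROVES the passage from the **module form** (finitely generated projective
`Γ(V, 𝒪_T)`-modules `P₀ —d→ P₁` with `H⁰(X_t, 𝒪(D_t)) ≅ Ker(d ⊗ κ(t))`, `LinearMap.baseChange` along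
the evaluation `Γ(V, 𝒪_T) → κ(t)`) to the matrix form, as pure algebra:
`exists_matrix_forall_ker_equiv_ker_baseChange` — for a linear map `d : P₀ → P₁` of finitely
generated projective modules over a commutative ring `A`, writing `P₀`, `P₁` as direct summands of
`A^m`, `A^n` (`π₀ s₀ = 1`, `π₁ s₁ = 1`, Mathlib `Module.Finite.exists_fin'`,
`Module.projective_lifting_property`), the stacked matrix `M = [s₁ d π₀ ; 1 - s₀ π₀] ∈ M_{(n+m) × m}(A)`
satisfies `Ker(M ⊗ B) ≅ Ker(d ⊗ B)` for EVERY `A`-algebra `B` (`kerInfKerEquivKerOfSplit`: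
`x ↦ π₀ x`, `p ↦ s₀ p`), and `M ⊗ B` is the matrix `M.map (algebraMap A B)` acting on `B^m`
(`piScalarRight_baseChange_toLin'`). No shrinking of `V` is needed, so the open set of the module
form is the open set of the matrix form. (This is the step "we may therefore assume that `E` is a
bounded above complex of free `𝒪`-modules of finite rank" of the proof of Prop. 23.117, p. 466.)

The module form itself is not a separate named fact: it is `grothendieckComplex_h0` reworded, with
the same printed proof — Čech complex of `𝒪(D)` over an affine base (flat, computing `H⁰` of all
fibres), perfectness of `Rf_*𝒪(D)` (Thm. 23.133: finiteness of coherent cohomology, noetherian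
approximation), base change of perfect complexes of flat modules (Mumford, *Abelian Varieties*, §5,
Lemma 2). `Motives/GrothendieckComplexCech` carries that proof out down to the one deep input, the
named fact `cechComplex_perfect` (Cor. 23.135 for the Čech complex of `𝒪(D)`), using this file for
the last step (`exists_matrix_chart_of_projective`, `grothendieckComplex_h0_of_cech`); Mathlib has
none of it (pin: `Mathlib/AlgebraicGeometry/Modules/` has sheaves of modules and `Tilde`;
`CategoryTheory/Sites/SheafCohomology/Cech` an abstract Čech complex functor; no cohomology of
quasi-coherent modules, no finiteness or base change for proper morphisms).

Mathlib searched and used (pin): `Module.Finite.exists_fin'`, `Module.projective_lifting_property`,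
`LinearMap.baseChange` with `baseChange_comp/id/sub`, `TensorProduct.piScalarRight`,
`LinearMap.toMatrix'`, `LinearMap.toMatrix'_mulVec`, `Matrix.fromRows`, `Matrix.fromRows_mulVec`,
`Matrix.fromRows_map`, `Matrix.submatrix_mulVec_equiv`, `RingHom.map_mulVec`,
`LinearEquiv.ofSubmodule'`, `Scheme.evaluation`; Mathlib has no statement relating kernels of base
changes of maps of projective modules to matrices, and nothing on higher direct images.

## References

* U. Görtz, T. Wedhorn, *Algebraic Geometry II: Cohomology of Schemes*, Springer Spektrum (2023),
  doi:10.1007/978-3-658-43031-3: Prop. 22.53, p. 360; proof of Prop. 23.117, p. 466; Thm. 23.133,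
  Rem. 23.134, Cor. 23.135, Cor. 23.137, pp. 478–480; Situation (S), (23.28.5), Thm. 23.139,
  pp. 481–483 (read via the held copy, pp. 478–483). [GortzWedhorn2023]
* U. Görtz, T. Wedhorn, *Algebraic Geometry I: Schemes*, 2nd ed. (2020): (11.9), Prop. 11.21,
  (11.16) (`𝒪(D)|_{X_t} ≅ 𝒪(D_t)`, `Γ(X, 𝒪_X(D)) ⊆ K(X)`). [GortzWedhorn2020]
* D. Mumford, *Abelian Varieties*, TIFR Studies in Mathematics 5 (1970): §5, the Grothendieck
  complex. [MumfordAV1970]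
-/

universe u v w

open CategoryTheory CategoryTheory.Limits AlgebraicGeometry MonoidalCategory
open CartesianMonoidalCategory
open Literature.AlgebraicGeometry.Motives.RatFn
open TensorProduct
open scoped Matrix

noncomputable section

namespace Literature.AlgebraicGeometry.Motives

/-! ### Kernels of maps of direct summands (pure linear algebra) -/

section Split

variable {B : Type*} [CommRing B] {F₀ P₀ P₁ F₁ : Type*}
  [AddCommGroup F₀] [Module B F₀] [AddCommGroup P₀] [Module B P₀]
  [AddCommGroup P₁] [Module B P₁] [AddCommGroup F₁] [Module B F₁]

/-- **Kernel of a map between direct summands.** If `π₀ : F₀ → P₀` has the section `s₀`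
(`π₀ s₀ = 1`), `s₁ : P₁ → F₁` is injective and `d : P₀ → P₁`, then
`Ker(s₁ d π₀) ∩ Ker(1 - s₀ π₀) ≅ Ker d`, by `x ↦ π₀ x` with inverse `p ↦ s₀ p`: on
`Ker(1 - s₀ π₀) = Im s₀ ≅ P₀` the map `s₁ d π₀` is `s₁ d`, whose kernel is that of `d`. [folklore] -/
def kerInfKerEquivKerOfSplit (π₀ : F₀ →ₗ[B] P₀) (s₀ : P₀ →ₗ[B] F₀) (h₀ : π₀ ∘ₗ s₀ = LinearMap.id)
    (s₁ : P₁ →ₗ[B] F₁) (hs₁ : Function.Injective s₁) (d : P₀ →ₗ[B] P₁) :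
    ↥(LinearMap.ker (s₁ ∘ₗ d ∘ₗ π₀) ⊓ LinearMap.ker (LinearMap.id - s₀ ∘ₗ π₀)) ≃ₗ[B]
      LinearMap.ker d where
  toFun x := ⟨π₀ x, by
    have hx := (Submodule.mem_inf.1 x.2).1
    rw [LinearMap.mem_ker, LinearMap.comp_apply, LinearMap.comp_apply] at hx
    rw [LinearMap.mem_ker]
    exact hs₁ (by rw [hx, map_zero])⟩
  invFun p := ⟨s₀ p, by
    have hp : d p = 0 := p.2
    have h₀' : π₀ (s₀ p) = p := by
      simpa using LinearMap.congr_fun h₀ (p : P₀)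
    refine Submodule.mem_inf.2 ⟨?_, ?_⟩
    · rw [LinearMap.mem_ker, LinearMap.comp_apply, LinearMap.comp_apply, h₀', hp, map_zero]
    · rw [LinearMap.mem_ker, LinearMap.sub_apply, LinearMap.id_apply, LinearMap.comp_apply, h₀',
        sub_self]⟩
  map_add' x y := by
    ext
    simp
  map_smul' c x := by
    ext
    simp
  left_inv x := by
    have hx := (Submodule.mem_inf.1 x.2).2
    rw [LinearMap.mem_ker, LinearMap.sub_apply, LinearMap.id_apply, LinearMap.comp_apply,
      sub_eq_zero] at hx
    ext
    exact hx.symm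
  right_inv p := by
    ext
    simpa using LinearMap.congr_fun h₀ (p : P₀)

end Split

/-! ### Base change of a map of finite free modules is the base-changed matrix -/

section BaseChange

variable {A : Type u} [CommRing A] (B : Type v) [CommRing B] [Algebra A B]

/-- **`G ⊗ B` in coordinates.** For an `A`-linear map `G : A^m → A^k` and an `A`-algebra `B`,
under the identifications `B ⊗_A A^j ≅ B^j` (Mathlib `TensorProduct.piScalarRight`) the base
change `G ⊗ B : B ⊗ A^m → B ⊗ A^k` is multiplication by the matrix of `G` mapped to `B`,
`(toMatrix' G).map (algebraMap A B)`. [folklore] -/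
theorem piScalarRight_baseChange_toLin' {m k : ℕ} (G : (Fin m → A) →ₗ[A] (Fin k → A))
    (z : B ⊗[A] (Fin m → A)) :
    TensorProduct.piScalarRight A B B (Fin k) (G.baseChange B z) =
      ((LinearMap.toMatrix' G).map (algebraMap A B)).mulVecLin
        (TensorProduct.piScalarRight A B B (Fin m) z) := by
  induction z using TensorProduct.induction_on with
  | zero => simp
  | add x y hx hy => simp only [map_add, hx, hy]
  | tmul b x =>
    rw [LinearMap.baseChange_tmul]
    simp only [TensorProduct.piScalarRight_apply, TensorProduct.piScalarRightHom_tmul,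
      Matrix.mulVecLin_apply]
    funext j
    have h1 : G x = LinearMap.toMatrix' G *ᵥ x := (LinearMap.toMatrix'_mulVec G x).symm
    have h2 : algebraMap A B ((LinearMap.toMatrix' G *ᵥ x) j) =
        ((LinearMap.toMatrix' G).map (algebraMap A B) *ᵥ ((algebraMap A B) ∘ x)) j :=
      RingHom.map_mulVec (algebraMap A B) (LinearMap.toMatrix' G) x j
    have h3 : (fun i => x i • b) = b • ((algebraMap A B) ∘ x) := by
      funext i
      simp [Algebra.smul_def, mul_comm]
    rw [h1, Algebra.smul_def, h2, h3, Matrix.mulVec_smul, Pi.smul_apply, smul_eq_mul, mul_comm]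

/-- The kernel of `G ⊗ B` is the kernel of the base-changed matrix of `G`, transported along
`B ⊗_A A^m ≅ B^m`: `z ∈ Ker(G ⊗ B) ↔ e(z) ∈ Ker((toMatrix' G).map (algebraMap A B))`. [folklore] -/
theorem mem_ker_baseChange_iff {m k : ℕ} (G : (Fin m → A) →ₗ[A] (Fin k → A))
    (z : B ⊗[A] (Fin m → A)) :
    z ∈ LinearMap.ker (G.baseChange B) ↔
      TensorProduct.piScalarRight A B B (Fin m) z ∈
        LinearMap.ker ((LinearMap.toMatrix' G).map (algebraMap A B)).mulVecLin := by
  rw [LinearMap.mem_ker, LinearMap.mem_ker, ← piScalarRight_baseChange_toLin',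
    LinearEquiv.map_eq_zero_iff]

end BaseChange

/-! ### Kernels of stacked and reindexed matrices -/

section Matrices

variable {B : Type*} [CommRing B] {m : ℕ}

/-- `Ker [N ; Q] = Ker N ∩ Ker Q` for the matrix obtained by stacking the rows of `N` on top of
those of `Q` (Mathlib `Matrix.fromRows`). [folklore] -/
theorem ker_mulVecLin_fromRows {ι₁ ι₂ : Type*} (N : Matrix ι₁ (Fin m) B) (Q : Matrix ι₂ (Fin m) B) :
    LinearMap.ker (Matrix.fromRows N Q).mulVecLin =
      LinearMap.ker N.mulVecLin ⊓ LinearMap.ker Q.mulVecLin := by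
  ext v
  simp only [LinearMap.mem_ker, Submodule.mem_inf, Matrix.mulVecLin_apply, Matrix.fromRows_mulVec,
    funext_iff, Sum.forall, Sum.elim_inl, Sum.elim_inr, Pi.zero_apply]

/-- Reindexing the rows of a matrix along a bijection does not change its kernel. [folklore] -/
theorem ker_mulVecLin_submatrix_equiv {ι ι' : Type*} [Fintype ι] [Fintype ι'] (M : Matrix ι (Fin m) B)
    (e : ι' ≃ ι) :
    LinearMap.ker (M.submatrix e id).mulVecLin = LinearMap.ker M.mulVecLin := by
  ext v
  simp only [LinearMap.mem_ker, Matrix.mulVecLin_apply]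
  rw [show (M.submatrix e id) = M.submatrix e (Equiv.refl _) from rfl, Matrix.submatrix_mulVec_equiv]
  constructor
  · intro h
    funext i
    have := congr_fun h (e.symm i)
    simpa using this
  · intro h
    funext i'
    simp [h]

end Matrices

/-! ### The matrix of a map of finite projective modules -/

section Projective

variable {A : Type u} [CommRing A] {P₀ : Type v} {P₁ : Type w}
  [AddCommGroup P₀] [Module A P₀] [AddCommGroup P₁] [Module A P₁]
  [Module.Finite A P₀] [Module.Projective A P₀] [Module.Finite A P₁] [Module.Projective A P₁]

/-- **The kernel of a map of finite projective modules, after any base change, is the kernel of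
one matrix.** For `d : P₀ → P₁` linear between finitely generated projective modules over a
commutative ring `A` there are `m`, `n` and a matrix `M ∈ M_{n × m}(A)` such that for every
(commutative) `A`-algebra `B`, `Ker(M ⊗ B : B^m → B^n) ≅ Ker(d ⊗ B)` `B`-linearly, `M ⊗ B` being
`M.map (algebraMap A B)`. Construction: `P₀`, `P₁` are direct summands of `A^m`, `A^{n'}`
(`π₀ s₀ = 1`, `π₁ s₁ = 1`), and `M` is the `(n' + m) × m` matrix of
`x ↦ (s₁ d π₀ x, x - s₀ π₀ x)`; these identities survive base change, and
`kerInfKerEquivKerOfSplit` applies over `B`. This is the step "choose bases of the finite locally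
free `Eⁱ` (after shrinking)" of Görtz–Wedhorn II, proof of Prop. 23.117 (p. 466), done without
shrinking. [folklore] -/
theorem exists_matrix_forall_ker_equiv_ker_baseChange (d : P₀ →ₗ[A] P₁) :
    ∃ (m n : ℕ) (M : Matrix (Fin n) (Fin m) A), ∀ (B : Type u) [CommRing B] [Algebra A B],
      Nonempty (LinearMap.ker (M.map (algebraMap A B)).mulVecLin ≃ₗ[B]
        LinearMap.ker (d.baseChange B)) := by
  classical
  obtain ⟨m, π₀, hπ₀⟩ := Module.Finite.exists_fin' A P₀
  obtain ⟨s₀, hs₀⟩ := Module.projective_lifting_property π₀ (LinearMap.id : P₀ →ₗ[A] P₀) hπ₀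
  obtain ⟨n, π₁, hπ₁⟩ := Module.Finite.exists_fin' A P₁
  obtain ⟨s₁, hs₁⟩ := Module.projective_lifting_property π₁ (LinearMap.id : P₁ →ₗ[A] P₁) hπ₁
  -- the two blocks `s₁ d π₀ : A^m → A^n` and `1 - s₀ π₀ : A^m → A^m`, as matrices
  set G₁ : (Fin m → A) →ₗ[A] (Fin n → A) := s₁ ∘ₗ d ∘ₗ π₀ with hG₁
  set G₂ : (Fin m → A) →ₗ[A] (Fin m → A) := LinearMap.id - s₀ ∘ₗ π₀ with hG₂
  set N : Matrix (Fin n) (Fin m) A := LinearMap.toMatrix' G₁ with hN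
  set Q : Matrix (Fin m) (Fin m) A := LinearMap.toMatrix' G₂ with hQ
  refine ⟨m, n + m, (Matrix.fromRows N Q).submatrix finSumFinEquiv.symm id, fun B _ _ => ⟨?_⟩⟩
  -- the split data after base change
  have h₀ : π₀.baseChange B ∘ₗ s₀.baseChange B = LinearMap.id := by
    rw [← LinearMap.baseChange_comp, hs₀, LinearMap.baseChange_id]
  have h₁ : Function.Injective (s₁.baseChange B) := by
    intro p q hpq
    have := congr_arg (π₁.baseChange B) hpq
    rwa [← LinearMap.comp_apply, ← LinearMap.comp_apply, ← LinearMap.baseChange_comp, hs₁,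
      LinearMap.baseChange_id, LinearMap.id_apply, LinearMap.id_apply] at this
  have hG₁B : G₁.baseChange B = s₁.baseChange B ∘ₗ d.baseChange B ∘ₗ π₀.baseChange B := by
    rw [hG₁, LinearMap.baseChange_comp, LinearMap.baseChange_comp]
  have hG₂B : G₂.baseChange B = LinearMap.id - s₀.baseChange B ∘ₗ π₀.baseChange B := by
    rw [hG₂, LinearMap.baseChange_sub, LinearMap.baseChange_id, LinearMap.baseChange_comp]
  -- (1) `Ker(G₁ ⊗ B) ∩ Ker(G₂ ⊗ B) ≅ Ker(d ⊗ B)`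
  have e₃ : ↥(LinearMap.ker (G₁.baseChange B) ⊓ LinearMap.ker (G₂.baseChange B)) ≃ₗ[B]
      LinearMap.ker (d.baseChange B) := by
    rw [hG₁B, hG₂B]
    exact kerInfKerEquivKerOfSplit _ _ h₀ _ h₁ _
  -- (2) transport along `B ⊗ A^m ≅ B^m` to the kernels of the matrices `N ⊗ B`, `Q ⊗ B`
  set e := TensorProduct.piScalarRight A B B (Fin m) with he
  have hcomap : (LinearMap.ker (N.map (algebraMap A B)).mulVecLin ⊓
      LinearMap.ker (Q.map (algebraMap A B)).mulVecLin).comap (e : B ⊗[A] (Fin m → A) →ₗ[B] _) =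
      LinearMap.ker (G₁.baseChange B) ⊓ LinearMap.ker (G₂.baseChange B) := by
    ext z
    simp only [Submodule.mem_comap, Submodule.mem_inf, LinearEquiv.coe_coe]
    rw [mem_ker_baseChange_iff B G₁ z, mem_ker_baseChange_iff B G₂ z]
  have e₂ : ↥(LinearMap.ker (N.map (algebraMap A B)).mulVecLin ⊓
      LinearMap.ker (Q.map (algebraMap A B)).mulVecLin) ≃ₗ[B]
      ↥(LinearMap.ker (G₁.baseChange B) ⊓ LinearMap.ker (G₂.baseChange B)) :=
    (e.ofSubmodule' _).symm.trans (LinearEquiv.ofEq _ _ hcomap)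
  -- (3) the stacked, reindexed matrix has kernel `Ker(N ⊗ B) ∩ Ker(Q ⊗ B)`
  have hker : LinearMap.ker (((Matrix.fromRows N Q).submatrix finSumFinEquiv.symm id).map
      (algebraMap A B)).mulVecLin = LinearMap.ker (N.map (algebraMap A B)).mulVecLin ⊓
      LinearMap.ker (Q.map (algebraMap A B)).mulVecLin := by
    rw [← Matrix.submatrix_map, ker_mulVecLin_submatrix_equiv, Matrix.fromRows_map,
      ker_mulVecLin_fromRows]
  exact (LinearEquiv.ofEq _ _ hker).trans (e₂.trans e₃)

end Projective

end Literature.AlgebraicGeometry.Motives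

end
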